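import Summits.CriticalPhenomena.Ising3DConformalLimit.Theorems.EnergyNotSigmaSquaredMoebiusLimitExistsPedigreeStepAux
import HarnessLib

/-!
# Cluster points of the pinned critical zoom are reflection positive in all NINE cubic mirror planes through the origin
(line `only-interaction-breaks-moebius`, crux `MoebiusLimitExists`, item stmt-CriticalPhenomena-1344, route
`EnergyNotSigmaSquared`; inherited constraints of the objects of the residue 5′)

For a cluster point `S` of the pinned zoom, continuous off the diagonals, and every cubic direction `g`
(`g ∈ {±e_τ, ±e_τ ± e_τ'}`, the normals of the nine site-mirror families of `ℤ³` in which the nearest-neighbour Ising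
model is reflection positive), with `θ_g = reflectZ g 0` the Euclidean reflection in the plane `{g·v = 0}`: for
finitely many injective configurations `zᵃ` strictly inside the open half-space `{g·v > 0}` and real coefficients `cₐ`,
`∑_{a,b} cₐ c_b S_{kₐ+k_b}(θ_g zᵃ ++ zᵇ) ≥ 0` (`clusterPoint_rp_cubicMirror`).
Proof: the site-mirror reflection positivity of the critical `ℤ³` state in the lattice plane `{g·v = 0}`
(`rp_latticeMirror_zero_cm`, FILS 1978 §2) applied to the lattice approximations `[zᵃ/δ]` (inside `{g· ≥ 0}` as soon as
`4δ` is below the least height, `floor_le_zdot_latticeApprox_ps`) with coefficients `cₐ ρ_pin(δ)^{kₐ}`, and the limit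
along the lifts `δ(Θ[zᵃ/δ] ++ [zᵇ/δ]) → (θ_g zᵃ ++ zᵇ)` (`norm_lift_latticeMirror_sub_reflectZ_le_ps`), where the zoom
converges to the continuous `S` (`TendstoLocallyUniformlyOn.tendsto_comp`). The three coordinate planes give the OS
positivity of `…ClusterPointOS.lean`; the six diagonal planes are the extra input of the hyperoctahedral routes
(`HyperoctahedralRP.CriticalCorrNineMirrorRP` is the lattice statement). No definitions.
-/

noncomputable section

open Filter Topology Set Function Metric
open Literature.Probability.LatticeModels

namespace Summit.CriticalPhenomena.Ising3DConformalLimit.MoebiusLimitExistsOnlyInteraction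

/-- The argument `θ_g zᵃ ++ zᵇ` of the Gram entry is a non-coincident configuration when `zᵃ`, `zᵇ` are injective and
strictly above the mirror (the reflected block is strictly below: `rdotZ g (θ_g v) = −rdotZ g v`). [folklore] -/
theorem append_reflectZ_mem_nonCoincident_nm {g : Site 3} (hg : IsCubicDir g) {ka kb : ℕ}
    {za : Fin ka → EuclideanSpace ℝ (Fin 3)} {zb : Fin kb → EuclideanSpace ℝ (Fin 3)}
    (ha : Function.Injective za) (hb : Function.Injective zb) (hapos : ∀ i, 0 < rdotZ g (za i))
    (hbpos : ∀ i, 0 < rdotZ g (zb i)) :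
    (Fin.append (fun i => reflectZ g 0 (za i)) zb : Fin (ka + kb) → EuclideanSpace ℝ (Fin 3)) ∈
      NonCoincident 3 (ka + kb) := by
  rw [mem_nonCoincident, Fin.append_injective_iff]
  refine ⟨(reflectZ_injective_dt hg 0).comp ha, hb, fun i j h => ?_⟩
  have h1 := congrArg (rdotZ g) h
  simp only [rdotZ_reflectZ_dt hg] at h1
  linarith [hapos i, hbpos j]

/-- **NINE-MIRROR REFLECTION POSITIVITY OF CLUSTER POINTS.** For a cluster point `S` of the pinned critical zoom,
continuous off the diagonals, a cubic direction `g`, finitely many injective configurations `zᵃ` strictly inside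
`{g·v > 0}` and real `cₐ`: `∑_{a,b} cₐ c_b S_{kₐ+k_b}(θ_g zᵃ ++ zᵇ) ≥ 0`, `θ_g = reflectZ g 0`. [cite: FILS1978, §2] -/
theorem clusterPoint_rp_cubicMirror {S : CorrFamily 3} (hS : IsClusterPoint S)
    (hcont : ∀ n, ContinuousOn (S n) (NonCoincident 3 n)) {g : Site 3} (hg : IsCubicDir g)
    (m : ℕ) (k : Fin m → ℕ) (z : (a : Fin m) → Fin (k a) → EuclideanSpace ℝ (Fin 3))
    (hzinj : ∀ a, Function.Injective (z a)) (hzpos : ∀ a i, 0 < rdotZ g (z a i)) (c : Fin m → ℝ) :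
    0 ≤ ∑ a, ∑ b, c a * c b * S (k a + k b) (Fin.append (fun i => reflectZ g 0 (z a i)) (z b)) := by
  classical
  obtain ⟨u, hu, hconv⟩ := hS
  have hupos : ∀ᶠ j in atTop, 0 < u j := (tendsto_nhdsWithin_iff.1 hu).2
  have hu0 : Tendsto u atTop (𝓝 0) := (tendsto_nhdsWithin_iff.1 hu).1
  -- a common positive lower bound of the heights
  obtain ⟨κ, hκ, hκle⟩ : ∃ κ : ℝ, 0 < κ ∧ ∀ a i, κ ≤ rdotZ g (z a i) := by
    by_cases hne : (Finset.univ : Finset (Σ a : Fin m, Fin (k a))).Nonempty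
    · obtain ⟨p₀, -, hmin⟩ := Finset.exists_min_image _ (fun p : Σ a : Fin m, Fin (k a) => rdotZ g (z p.1 p.2)) hne
      exact ⟨rdotZ g (z p₀.1 p₀.2), hzpos _ _, fun a i => hmin ⟨a, i⟩ (Finset.mem_univ _)⟩
    · refine ⟨1, one_pos, fun a i => ?_⟩
      exact absurd ⟨⟨a, i⟩, Finset.mem_univ _⟩ hne
  have hsmall : ∀ᶠ j in atTop, u j < κ / 4 := hu0.eventually (gt_mem_nhds (by positivity))
  -- lattice data and lifts
  set y : ℕ → (a : Fin m) → Fin (k a) → Site 3 := fun j a i => latticeApprox (u j) (z a i) with hy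
  set L : ℕ → (a b : Fin m) → Fin (k a + k b) → EuclideanSpace ℝ (Fin 3) := fun j a b l =>
    u j • siteVec (Fin.append (latticeMirror g 0 ∘ y j a) (y j b) l) with hL
  set w : (a b : Fin m) → Fin (k a + k b) → EuclideanSpace ℝ (Fin 3) := fun a b =>
    Fin.append (fun i => reflectZ g 0 (z a i)) (z b) with hw
  have hwmem : ∀ a b, w a b ∈ NonCoincident 3 (k a + k b) := fun a b =>
    append_reflectZ_mem_nonCoincident_nm hg (hzinj a) (hzinj b) (hzpos a) (hzpos b)
  have hLw : ∀ a b, Tendsto (fun j => L j a b) atTop (𝓝[NonCoincident 3 (k a + k b)] (w a b)) := by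
    intro a b
    have hconv' : Tendsto (fun j => L j a b) atTop (𝓝 (w a b)) := by
      refine tendsto_pi_nhds.2 fun l => ?_
      rw [tendsto_iff_norm_sub_tendsto_zero]
      refine squeeze_zero' (Eventually.of_forall fun j => norm_nonneg _) ?_
        (by simpa using hu0.const_mul (22 : ℝ))
      filter_upwards [hupos] with j hj
      rw [hL, hw]
      refine Fin.addCases (fun l => ?_) (fun l => ?_) l
      · simp only [Fin.append_left, Function.comp_apply]
        have h := norm_lift_latticeMirror_sub_reflectZ_le_ps hg hj 0 (z a l)
        rwa [zero_div, Int.floor_zero] at h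
      · simp only [Fin.append_right]
        linarith [norm_lift_latticeApprox_sub_le_ps hj (z b l)]
    exact tendsto_nhdsWithin_iff.2
      ⟨hconv', hconv'.eventually_mem ((isOpen_nonCoincident 3 _).mem_nhds (hwmem a b))⟩
  have hlim : ∀ a b, Tendsto (fun j => rescaledCorrelator (criticalCorr 3) rhoPin (k a + k b) (u j) (L j a b))
      atTop (𝓝 (S (k a + k b) (w a b))) := fun a b =>
    (hconv _).tendsto_comp ((hcont _).continuousWithinAt (hwmem a b)) (hwmem a b) (hLw a b)
  -- lattice reflection positivity at every small positive mesh
  have hpos : ∀ᶠ j in atTop, 0 ≤ ∑ a, ∑ b, c a * c b *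
      rescaledCorrelator (criticalCorr 3) rhoPin (k a + k b) (u j) (L j a b) := by
    filter_upwards [hupos, hsmall] with j hj hjs
    have hz : ∀ a i, 0 ≤ zdot g (y j a i) := fun a i => by
      have h := floor_le_zdot_latticeApprox_ps (T := 0) (κ := κ) hg hj (by linarith)
        (p := z a i) (by linarith [hκle a i])
      rwa [zero_div, Int.floor_zero] at h
    have h := rp_latticeMirror_zero_cm hg m k (y j) (fun a => c a * rhoPin (u j) ^ k a) hz
    refine h.trans_eq (Finset.sum_congr rfl fun a _ => Finset.sum_congr rfl fun b _ => ?_)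
    rw [hL]
    simp only []
    rw [rescaledCorrelator_lift_ps hj, pow_add]
    ring
  exact ge_of_tendsto (tendsto_finsetSum _ fun a _ => tendsto_finsetSum _ fun b _ => (hlim a b).const_mul _) hpos

/-- **Registered anchor** (`clusterPoint_nineMirrorRP`): the closed form of `clusterPoint_rp_cubicMirror`.
[cite: FILS1978, §2] -/
theorem clusterPoint_nineMirrorRP :
    ∀ (S : CorrFamily 3), IsClusterPoint S → (∀ n, ContinuousOn (S n) (NonCoincident 3 n)) →
      ∀ (g : Site 3), IsCubicDir g → ∀ (m : ℕ) (k : Fin m → ℕ)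
        (z : (a : Fin m) → Fin (k a) → EuclideanSpace ℝ (Fin 3)) (c : Fin m → ℝ),
        (∀ a, Function.Injective (z a)) → (∀ a i, 0 < rdotZ g (z a i)) →
        0 ≤ ∑ a, ∑ b, c a * c b * S (k a + k b) (Fin.append (fun i => reflectZ g 0 (z a i)) (z b)) :=
  fun _ hS hcont _ hg m k z c hzinj hzpos => clusterPoint_rp_cubicMirror hS hcont hg m k z hzinj hzpos c

end Summit.CriticalPhenomena.Ising3DConformalLimit.MoebiusLimitExistsOnlyInteraction

end
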